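import Literature.Computability.MetaComplexity.LevelledRefutationCNFAdversary
import HarnessLib

/-!
# Garlík's adversary for `REF^F_{s,t}`: clause surgery, updates, cleanup, filling a clause

Support file for the proof of `levelledRefCNF_lowerBound` ([Garlík 2019, Thm 1]); second part of
the deterministic half of [Garlík 2019, §4]. It provides the constructions used in the proof of
[Garlík 2019, Lemma 19]:

* a small library of clauses over variable *indices* (`NonTaut`, `InRange`, `IsFullCl`,
  `allNeg`, `fullExt`, `replaceLit`) — the "non-tautological clause with `n` literals" and the
  clause `(C ∖ {¬x_ℓ}) ∪ {x_ℓ}` of [Garlík 2019, proof of Lemma 19, Cases 2–3];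
* point updates of structured assignments (`PA.setD/setV/setI/setL/setR`) and the admissibility
  of the elementary extensions (setting a cut variable, an `F`-clause, a clause together with
  its cut variable / `F`-clause: [Garlík 2019, Lemma 19, Cases 1–2]);
* the three-step *cleanup* `σ ↦ σ₁` of [Garlík 2019, proof of Lemma 19] (`clean`), its
  admissibility, and the bound on the number of pairs of a level at which `σ₁` sets a group
  (`card_setPairs_clean_le`, the count behind `|U_1| ≤ 10pt + 4w`);
* `fillD`: [Garlík 2019, Lemma 19, Case 2] — extending an admissible assignment by the clause of
  a pair that is not `D`-mentioned.

## References

* M. Garlík, *Resolution lower bounds for refutation statements*, MFCS 2019 / arXiv:1905.12372,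
  §4, Lemma 19 (Cases 1–3 and the cleanup).
-/

namespace Literature.Computability.MetaComplexity

open _root_.Computability Complexity

namespace LevelledRefCNF

/-! ### Clauses over variable indices -/

section IdxClauses

/-- A clause over variable indices is non-tautological. [cite: Garlik2019, §2] -/
def NonTaut (C : Finset (ℕ × Bool)) : Prop :=
  ∀ ℓ, ¬ ((ℓ, true) ∈ C ∧ (ℓ, false) ∈ C)

/-- A clause over variable indices only uses the indices `< n`. [folklore] -/
def InRange (n : ℕ) (C : Finset (ℕ × Bool)) : Prop :=
  C ⊆ Finset.range n ×ˢ Finset.univ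

/-- A *full* clause: non-tautological with exactly one literal on each of `x_0, …, x_{n-1}`
("a non-tautological clause with `n` literals"). [cite: Garlik2019, proof of Lemma 17] -/
def IsFullCl (n : ℕ) (C : Finset (ℕ × Bool)) : Prop :=
  InRange n C ∧ NonTaut C ∧ ∀ ℓ < n, (ℓ, true) ∈ C ∨ (ℓ, false) ∈ C

/-- Membership in the range product. [folklore] -/
theorem InRange.lt {n : ℕ} {C : Finset (ℕ × Bool)} (h : InRange n C) {q : ℕ × Bool} (hq : q ∈ C) :
    q.1 < n := by
  have := h hq
  simp only [Finset.mem_product, Finset.mem_range] at this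
  exact this.1

/-- A clause is in range iff all its variable indices are `< n`. [folklore] -/
theorem inRange_iff {n : ℕ} {C : Finset (ℕ × Bool)} : InRange n C ↔ ∀ q ∈ C, q.1 < n := by
  refine ⟨fun h q hq => h.lt hq, fun h q hq => ?_⟩
  simp only [Finset.mem_product, Finset.mem_range, Finset.mem_univ, and_true]
  exact h q hq

/-- A non-tautological clause in range has at most `n` literals (its literals have distinct
variables). [folklore] -/
theorem card_le_of_nonTaut {n : ℕ} {C : Finset (ℕ × Bool)} (hr : InRange n C) (hnt : NonTaut C) :
    C.card ≤ n := by
  have hinj : Set.InjOn Prod.fst (C : Set (ℕ × Bool)) := by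
    rintro ⟨a, b⟩ ha ⟨a', b'⟩ ha' (h : a = a')
    subst h
    cases b <;> cases b'
    · rfl
    · exact absurd ⟨ha', ha⟩ (hnt a)
    · exact absurd ⟨ha, ha'⟩ (hnt a)
    · rfl
  calc C.card = (C.image Prod.fst).card := (Finset.card_image_of_injOn hinj).symm
    _ ≤ (Finset.range n).card := Finset.card_le_card (fun a ha => by
        obtain ⟨q, hq, rfl⟩ := Finset.mem_image.1 ha
        exact Finset.mem_range.2 (hr.lt hq))
    _ = n := Finset.card_range n

/-- A full clause has exactly `n` literals. [folklore] -/
theorem IsFullCl.card_eq {n : ℕ} {C : Finset (ℕ × Bool)} (h : IsFullCl n C) : C.card = n := by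
  obtain ⟨hr, hnt, hall⟩ := h
  have hinj : Set.InjOn Prod.fst (C : Set (ℕ × Bool)) := by
    rintro ⟨a, b⟩ ha ⟨a', b'⟩ ha' (h : a = a')
    subst h
    cases b <;> cases b'
    · rfl
    · exact absurd ⟨ha', ha⟩ (hnt a)
    · exact absurd ⟨ha, ha'⟩ (hnt a)
    · rfl
  calc C.card = (C.image Prod.fst).card := (Finset.card_image_of_injOn hinj).symm
    _ = (Finset.range n).card := by
        congr 1
        ext a
        simp only [Finset.mem_image, Finset.mem_range]
        constructor
        · rintro ⟨q, hq, rfl⟩; exact hr.lt hq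
        · intro ha
          rcases hall a ha with h | h
          · exact ⟨_, h, rfl⟩
          · exact ⟨_, h, rfl⟩
    _ = n := Finset.card_range n

/-- In a full clause, a variable index `< n` carries the literal of exactly the sign present.
[folklore] -/
theorem IsFullCl.mem_iff_not_mem {n : ℕ} {C : Finset (ℕ × Bool)} (h : IsFullCl n C) {ℓ : ℕ}
    (hℓ : ℓ < n) (b : Bool) : (ℓ, b) ∈ C ↔ (ℓ, !b) ∉ C := by
  obtain ⟨-, hnt, hall⟩ := h
  cases b
  · constructor
    · exact fun h1 h2 => hnt ℓ ⟨h2, h1⟩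
    · intro h2; rcases hall ℓ hℓ with h | h
      · exact absurd h h2
      · exact h
  · constructor
    · exact fun h1 h2 => hnt ℓ ⟨h1, h2⟩
    · intro h2; rcases hall ℓ hℓ with h | h
      · exact h
      · exact absurd h h2

/-- The all-negative full clause `¬x_0 ∨ ⋯ ∨ ¬x_{n-1}`. [folklore] -/
def allNeg (n : ℕ) : Finset (ℕ × Bool) :=
  (Finset.range n).image fun ℓ => (ℓ, false)

/-- Membership in `allNeg`. [folklore] -/
@[simp] theorem mem_allNeg {n : ℕ} {q : ℕ × Bool} : q ∈ allNeg n ↔ q.1 < n ∧ q.2 = false := by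
  constructor
  · intro h
    obtain ⟨ℓ, hℓ, rfl⟩ := Finset.mem_image.1 h
    exact ⟨Finset.mem_range.1 hℓ, rfl⟩
  · rintro ⟨h1, h2⟩
    exact Finset.mem_image.2 ⟨q.1, Finset.mem_range.2 h1, by rw [← h2]⟩

/-- `allNeg n` is full. [folklore] -/
theorem isFullCl_allNeg (n : ℕ) : IsFullCl n (allNeg n) := by
  refine ⟨fun q hq => ?_, fun ℓ h => ?_, fun ℓ hℓ => Or.inr (by simp [hℓ])⟩
  · simp only [Finset.mem_product, Finset.mem_range, Finset.mem_univ, and_true]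
    exact (mem_allNeg.1 hq).1
  · simp at h

/-- The full extension of a clause `B`: add `¬x_ℓ` for every variable `x_ℓ`, `ℓ < n`, not
occurring in `B`. [cite: Garlik2019, proof of Lemma 19, Case 2 ("any non-tautological clause
with n literals that contains the literals of C_m")] -/
def fullExt (n : ℕ) (B : Finset (ℕ × Bool)) : Finset (ℕ × Bool) :=
  B ∪ ((Finset.range n).filter fun ℓ => (ℓ, true) ∉ B ∧ (ℓ, false) ∉ B).image fun ℓ => (ℓ, false)

/-- `B ⊆ fullExt n B`. [folklore] -/
theorem subset_fullExt (n : ℕ) (B : Finset (ℕ × Bool)) : B ⊆ fullExt n B :=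
  Finset.subset_union_left

/-- Membership in `fullExt`. [folklore] -/
theorem mem_fullExt {n : ℕ} {B : Finset (ℕ × Bool)} {q : ℕ × Bool} :
    q ∈ fullExt n B ↔ q ∈ B ∨ (q.1 < n ∧ (q.1, true) ∉ B ∧ (q.1, false) ∉ B ∧ q.2 = false) := by
  simp only [fullExt, Finset.mem_union, Finset.mem_image, Finset.mem_filter, Finset.mem_range]
  constructor
  · rintro (h | ⟨ℓ, ⟨hℓ, h1, h2⟩, rfl⟩)
    · exact Or.inl h
    · exact Or.inr ⟨hℓ, h1, h2, rfl⟩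
  · rintro (h | ⟨hℓ, h1, h2, h3⟩)
    · exact Or.inl h
    · exact Or.inr ⟨q.1, ⟨hℓ, h1, h2⟩, by rw [← h3]⟩

/-- The full extension of a non-tautological clause in range is full. [folklore] -/
theorem isFullCl_fullExt {n : ℕ} {B : Finset (ℕ × Bool)} (hr : InRange n B) (hnt : NonTaut B) :
    IsFullCl n (fullExt n B) := by
  refine ⟨fun q hq => ?_, fun ℓ h => ?_, fun ℓ hℓ => ?_⟩
  · simp only [Finset.mem_product, Finset.mem_range, Finset.mem_univ, and_true]
    rcases mem_fullExt.1 hq with h | h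
    · exact hr.lt h
    · exact h.1
  · rcases h with ⟨h1, h2⟩
    rcases mem_fullExt.1 h1 with h1 | h1
    · rcases mem_fullExt.1 h2 with h2 | h2
      · exact hnt ℓ ⟨h1, h2⟩
      · exact h2.2.1 h1
    · simp at h1
  · by_cases h1 : (ℓ, true) ∈ B
    · exact Or.inl (subset_fullExt n B h1)
    · by_cases h2 : (ℓ, false) ∈ B
      · exact Or.inr (subset_fullExt n B h2)
      · exact Or.inr (mem_fullExt.2 (Or.inr ⟨hℓ, h1, h2, rfl⟩))

/-- `C[ℓ ↦ b]`: the clause `C` with its literal on `x_ℓ` (if any) replaced by `x_ℓ^b` — the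
clause `(C ∖ {x_ℓ^{1-b}}) ∪ {x_ℓ^b}` of [Garlík 2019, proof of Lemma 19, Case 3].
[cite: Garlik2019, proof of Lemma 19, Case 3] -/
def replaceLit (C : Finset (ℕ × Bool)) (ℓ : ℕ) (b : Bool) : Finset (ℕ × Bool) :=
  insert (ℓ, b) (C.filter fun q => q.1 ≠ ℓ)

/-- Membership in `replaceLit`. [folklore] -/
theorem mem_replaceLit {C : Finset (ℕ × Bool)} {ℓ : ℕ} {b : Bool} {q : ℕ × Bool} :
    q ∈ replaceLit C ℓ b ↔ q = (ℓ, b) ∨ (q ∈ C ∧ q.1 ≠ ℓ) := by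
  simp [replaceLit]

/-- The new literal is in `C[ℓ ↦ b]`. [folklore] -/
theorem mem_replaceLit_self (C : Finset (ℕ × Bool)) (ℓ : ℕ) (b : Bool) :
    (ℓ, b) ∈ replaceLit C ℓ b :=
  mem_replaceLit.2 (Or.inl rfl)

/-- The opposite literal is not in `C[ℓ ↦ b]`. [folklore] -/
theorem not_mem_replaceLit_not (C : Finset (ℕ × Bool)) (ℓ : ℕ) (b : Bool) :
    (ℓ, !b) ∉ replaceLit C ℓ b := by
  rw [mem_replaceLit]
  rintro (h | h)
  · simp only [Prod.mk.injEq, true_and] at h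
    cases b <;> simp at h
  · exact h.2 rfl

/-- Every literal of `C[ℓ ↦ b]` other than `x_ℓ^b` is a literal of `C`. [folklore] -/
theorem mem_of_mem_replaceLit {C : Finset (ℕ × Bool)} {ℓ : ℕ} {b : Bool} {q : ℕ × Bool}
    (hq : q ∈ replaceLit C ℓ b) (hne : q ≠ (ℓ, b)) : q ∈ C := by
  rcases mem_replaceLit.1 hq with h | h
  · exact absurd h hne
  · exact h.1

/-- `C[ℓ ↦ b]` is non-tautological if `C` is. [folklore] -/
theorem nonTaut_replaceLit {C : Finset (ℕ × Bool)} (hnt : NonTaut C) (ℓ : ℕ) (b : Bool) :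
    NonTaut (replaceLit C ℓ b) := by
  intro k ⟨h1, h2⟩
  rcases mem_replaceLit.1 h1 with h1 | h1 <;> rcases mem_replaceLit.1 h2 with h2 | h2
  · simp only [Prod.mk.injEq] at h1 h2
    rw [← h1.2] at h2; exact Bool.noConfusion h2.2
  · simp only [Prod.mk.injEq] at h1; exact h2.2 h1.1
  · simp only [Prod.mk.injEq] at h2; exact h1.2 h2.1
  · exact hnt k ⟨h1.1, h2.1⟩

/-- `C[ℓ ↦ b]` is in range if `C` is and `ℓ < n`. [folklore] -/
theorem inRange_replaceLit {n : ℕ} {C : Finset (ℕ × Bool)} (hr : InRange n C) {ℓ : ℕ}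
    (hℓ : ℓ < n) (b : Bool) : InRange n (replaceLit C ℓ b) := by
  rw [inRange_iff]
  intro q hq
  rcases mem_replaceLit.1 hq with rfl | h
  · exact hℓ
  · exact hr.lt h.1

/-- If every variable other than `x_ℓ` occurs in `C` then `C[ℓ ↦ b]` is full. [folklore] -/
theorem isFullCl_replaceLit {n : ℕ} {C : Finset (ℕ × Bool)} (hr : InRange n C) (hnt : NonTaut C)
    {ℓ : ℕ} (hℓ : ℓ < n) (b : Bool)
    (hall : ∀ k < n, k ≠ ℓ → (k, true) ∈ C ∨ (k, false) ∈ C) : IsFullCl n (replaceLit C ℓ b) := by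
  refine ⟨inRange_replaceLit hr hℓ b, nonTaut_replaceLit hnt ℓ b, fun k hk => ?_⟩
  by_cases hkℓ : k = ℓ
  · subst hkℓ
    cases b
    · exact Or.inr (mem_replaceLit_self C k false)
    · exact Or.inl (mem_replaceLit_self C k true)
  · rcases hall k hk hkℓ with h | h
    · exact Or.inl (mem_replaceLit.2 (Or.inr ⟨h, hkℓ⟩))
    · exact Or.inr (mem_replaceLit.2 (Or.inr ⟨h, hkℓ⟩))

/-- **Almost full clauses.** A non-tautological clause in range with at least `n - 1` literals
which, if not full, avoids `x_ℓ`, contains a literal on every variable other than `x_ℓ`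
(the situation of condition (C4) of [Garlík 2019, Def. 15] on the level below the top).
[cite: Garlik2019, proof of Lemma 19, Case 3 (i = 2)] -/
theorem forall_mem_of_card {n : ℕ} {C : Finset (ℕ × Bool)} (hr : InRange n C) (hnt : NonTaut C)
    {ℓ : ℕ} (hℓ : ℓ < n) (hcard : n ≤ C.card + 1)
    (hcut : C.card < n → (ℓ, true) ∉ C ∧ (ℓ, false) ∉ C) :
    ∀ k < n, k ≠ ℓ → (k, true) ∈ C ∨ (k, false) ∈ C := by
  classical
  have hinj : Set.InjOn Prod.fst (C : Set (ℕ × Bool)) := by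
    rintro ⟨a, b⟩ ha ⟨a', b'⟩ ha' (h : a = a')
    subst h
    cases b <;> cases b'
    · rfl
    · exact absurd ⟨ha', ha⟩ (hnt a)
    · exact absurd ⟨ha, ha'⟩ (hnt a)
    · rfl
  have hvars : (C.image Prod.fst).card = C.card := Finset.card_image_of_injOn hinj
  intro k hk hkℓ
  by_contra hcon
  push Not at hcon
  have hk_not : k ∉ C.image Prod.fst := by
    intro h
    obtain ⟨⟨a, b⟩, hq, rfl⟩ := Finset.mem_image.1 h
    cases b
    · exact hcon.2 hq
    · exact hcon.1 hq
  by_cases hfull : C.card < n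
  · -- then `ℓ` and `k` are two distinct missing variables: too few literals
    have hℓ_not : ℓ ∉ C.image Prod.fst := by
      intro h
      obtain ⟨⟨a, b⟩, hq, rfl⟩ := Finset.mem_image.1 h
      cases b
      · exact (hcut hfull).2 hq
      · exact (hcut hfull).1 hq
    have hsub : C.image Prod.fst ⊆ ((Finset.range n).erase k).erase ℓ := by
      intro a ha
      simp only [Finset.mem_erase, Finset.mem_range]
      obtain ⟨q, hq, rfl⟩ := Finset.mem_image.1 ha
      exact ⟨fun h => hℓ_not (h ▸ ha), fun h => hk_not (h ▸ ha), hr.lt hq⟩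
    have := Finset.card_le_card hsub
    rw [Finset.card_erase_of_mem (by simp [hℓ, Ne.symm hkℓ]), Finset.card_erase_of_mem
      (by simp [hk]), Finset.card_range, hvars] at this
    omega
  · have hsub : C.image Prod.fst ⊆ (Finset.range n).erase k := by
      intro a ha
      simp only [Finset.mem_erase, Finset.mem_range]
      obtain ⟨q, hq, rfl⟩ := Finset.mem_image.1 ha
      exact ⟨fun h => hk_not (h ▸ ha), hr.lt hq⟩
    have := Finset.card_le_card hsub
    rw [Finset.card_erase_of_mem (by simp [hk]), Finset.card_range, hvars] at this
    omega

/-- Adding the literal `x_ℓ^b` to a clause avoiding `x_ℓ` gives a non-tautological clause with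
one more literal. [cite: Garlik2019, proof of Lemma 19, Case 3 (the clause C ∪ {x_ℓ})] -/
theorem nonTaut_insert {C : Finset (ℕ × Bool)} (hnt : NonTaut C) {ℓ : ℕ} {b : Bool}
    (h : (ℓ, !b) ∉ C) : NonTaut (insert (ℓ, b) C) := by
  intro k ⟨h1, h2⟩
  rw [Finset.mem_insert] at h1 h2
  rcases h1 with h1 | h1 <;> rcases h2 with h2 | h2
  · simp only [Prod.mk.injEq] at h1 h2
    rw [← h1.2] at h2; exact Bool.noConfusion h2.2
  · simp only [Prod.mk.injEq] at h1
    obtain ⟨rfl, rfl⟩ := h1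
    exact h h2
  · simp only [Prod.mk.injEq] at h2
    obtain ⟨rfl, rfl⟩ := h2
    exact h h1
  · exact hnt k ⟨h1, h2⟩

/-- Adding an in-range literal keeps a clause in range. [folklore] -/
theorem inRange_insert {n : ℕ} {C : Finset (ℕ × Bool)} (hr : InRange n C) {ℓ : ℕ} (hℓ : ℓ < n)
    (b : Bool) : InRange n (insert (ℓ, b) C) := by
  rw [inRange_iff] at hr ⊢
  intro q hq
  rcases Finset.mem_insert.1 hq with rfl | hq
  · exact hℓ
  · exact hr q hq

/-- A non-full non-tautological clause in range misses some variable. [folklore] -/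
theorem exists_not_mem_of_card_lt {n : ℕ} {C : Finset (ℕ × Bool)} (hr : InRange n C)
    (hcard : C.card < n) : ∃ k < n, (k, true) ∉ C ∧ (k, false) ∉ C := by
  classical
  by_contra hcon
  push Not at hcon
  have hsub : Finset.range n ⊆ C.image Prod.fst := by
    intro k hk
    rcases em ((k, true) ∈ C) with h | h
    · exact Finset.mem_image.2 ⟨_, h, rfl⟩
    · exact Finset.mem_image.2 ⟨_, hcon k (Finset.mem_range.1 hk) h, rfl⟩
  have h1 := Finset.card_le_card hsub
  rw [Finset.card_range] at h1
  have h2 : (C.image Prod.fst).card ≤ C.card := Finset.card_image_le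
  have _ := hr
  omega

end IdxClauses

/-! ### Point updates of structured assignments -/

section Updates

/-- Set the clause of the pair `q`. [folklore] -/
def PA.setD (σ : PA) (q : ℕ × ℕ) (C : Finset (ℕ × Bool)) : PA :=
  { σ with D := Function.update σ.D q (some C) }

/-- Set the cut variable of the pair `q`. [folklore] -/
def PA.setV (σ : PA) (q : ℕ × ℕ) (k : ℕ) : PA :=
  { σ with V := Function.update σ.V q (some k) }

/-- Set the `F`-clause of the level-`0` position `j`. [folklore] -/
def PA.setI (σ : PA) (j : ℕ) (m : ℕ) : PA :=
  { σ with I := Function.update σ.I j (some m) }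

/-- Set the `L`-premise of the pair `q`. [folklore] -/
def PA.setL (σ : PA) (q : ℕ × ℕ) (k : ℕ) : PA :=
  { σ with L := Function.update σ.L q (some k) }

/-- Set the `R`-premise of the pair `q`. [folklore] -/
def PA.setR (σ : PA) (q : ℕ × ℕ) (k : ℕ) : PA :=
  { σ with R := Function.update σ.R q (some k) }

variable (σ : PA) (q : ℕ × ℕ)

/-- Reading a field after an update (definitional). [folklore] -/
@[simp] theorem PA.setD_D (C : Finset (ℕ × Bool)) :
    (σ.setD q C).D = Function.update σ.D q (some C) := rfl
/-- Reading a field after an update (definitional). [folklore] -/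
@[simp] theorem PA.setD_V (C : Finset (ℕ × Bool)) : (σ.setD q C).V = σ.V := rfl
/-- Reading a field after an update (definitional). [folklore] -/
@[simp] theorem PA.setD_I (C : Finset (ℕ × Bool)) : (σ.setD q C).I = σ.I := rfl
/-- Reading a field after an update (definitional). [folklore] -/
@[simp] theorem PA.setD_L (C : Finset (ℕ × Bool)) : (σ.setD q C).L = σ.L := rfl
/-- Reading a field after an update (definitional). [folklore] -/
@[simp] theorem PA.setD_R (C : Finset (ℕ × Bool)) : (σ.setD q C).R = σ.R := rfl
/-- Reading a field after an update (definitional). [folklore] -/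
@[simp] theorem PA.setV_D (k : ℕ) : (σ.setV q k).D = σ.D := rfl
/-- Reading a field after an update (definitional). [folklore] -/
@[simp] theorem PA.setV_V (k : ℕ) : (σ.setV q k).V = Function.update σ.V q (some k) := rfl
/-- Reading a field after an update (definitional). [folklore] -/
@[simp] theorem PA.setV_I (k : ℕ) : (σ.setV q k).I = σ.I := rfl
/-- Reading a field after an update (definitional). [folklore] -/
@[simp] theorem PA.setV_L (k : ℕ) : (σ.setV q k).L = σ.L := rfl
/-- Reading a field after an update (definitional). [folklore] -/
@[simp] theorem PA.setV_R (k : ℕ) : (σ.setV q k).R = σ.R := rfl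
/-- Reading a field after an update (definitional). [folklore] -/
@[simp] theorem PA.setI_D (j m : ℕ) : (σ.setI j m).D = σ.D := rfl
/-- Reading a field after an update (definitional). [folklore] -/
@[simp] theorem PA.setI_V (j m : ℕ) : (σ.setI j m).V = σ.V := rfl
/-- Reading a field after an update (definitional). [folklore] -/
@[simp] theorem PA.setI_I (j m : ℕ) : (σ.setI j m).I = Function.update σ.I j (some m) := rfl
/-- Reading a field after an update (definitional). [folklore] -/
@[simp] theorem PA.setI_L (j m : ℕ) : (σ.setI j m).L = σ.L := rfl
/-- Reading a field after an update (definitional). [folklore] -/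
@[simp] theorem PA.setI_R (j m : ℕ) : (σ.setI j m).R = σ.R := rfl
/-- Reading a field after an update (definitional). [folklore] -/
@[simp] theorem PA.setL_D (k : ℕ) : (σ.setL q k).D = σ.D := rfl
/-- Reading a field after an update (definitional). [folklore] -/
@[simp] theorem PA.setL_V (k : ℕ) : (σ.setL q k).V = σ.V := rfl
/-- Reading a field after an update (definitional). [folklore] -/
@[simp] theorem PA.setL_I (k : ℕ) : (σ.setL q k).I = σ.I := rfl
/-- Reading a field after an update (definitional). [folklore] -/
@[simp] theorem PA.setL_L (k : ℕ) : (σ.setL q k).L = Function.update σ.L q (some k) := rfl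
/-- Reading a field after an update (definitional). [folklore] -/
@[simp] theorem PA.setL_R (k : ℕ) : (σ.setL q k).R = σ.R := rfl
/-- Reading a field after an update (definitional). [folklore] -/
@[simp] theorem PA.setR_D (k : ℕ) : (σ.setR q k).D = σ.D := rfl
/-- Reading a field after an update (definitional). [folklore] -/
@[simp] theorem PA.setR_V (k : ℕ) : (σ.setR q k).V = σ.V := rfl
/-- Reading a field after an update (definitional). [folklore] -/
@[simp] theorem PA.setR_I (k : ℕ) : (σ.setR q k).I = σ.I := rfl
/-- Reading a field after an update (definitional). [folklore] -/
@[simp] theorem PA.setR_L (k : ℕ) : (σ.setR q k).L = σ.L := rfl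
/-- Reading a field after an update (definitional). [folklore] -/
@[simp] theorem PA.setR_R (k : ℕ) : (σ.setR q k).R = Function.update σ.R q (some k) := rfl

variable {σ q}

/-- Setting an unset clause is an extension. [folklore] -/
theorem Ext.setD (h : σ.D q = none) (C : Finset (ℕ × Bool)) : Ext σ (σ.setD q C) := by
  refine ⟨fun q' C' h' => ?_, fun _ _ h => h, fun _ _ h => h, fun _ _ h => h, fun _ _ h => h⟩
  simp only [PA.setD_D, Function.update_apply]
  split_ifs with hq
  · subst hq; rw [h] at h'; exact absurd h' (by simp)
  · exact h'

/-- Setting an unset (or equal) cut variable is an extension. [folklore] -/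
theorem Ext.setV {k : ℕ} (h : σ.V q = none ∨ σ.V q = some k) : Ext σ (σ.setV q k) := by
  refine ⟨fun _ _ h => h, fun q' k' h' => ?_, fun _ _ h => h, fun _ _ h => h, fun _ _ h => h⟩
  simp only [PA.setV_V, Function.update_apply]
  split_ifs with hq
  · subst hq; rcases h with h | h <;> rw [h] at h'
    · exact absurd h' (by simp)
    · simp only [Option.some.injEq] at h'; rw [h']
  · exact h'

/-- Setting an unset `F`-clause is an extension. [folklore] -/
theorem Ext.setI {j m : ℕ} (h : σ.I j = none ∨ σ.I j = some m) : Ext σ (σ.setI j m) := by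
  refine ⟨fun _ _ h => h, fun _ _ h => h, fun j' m' h' => ?_, fun _ _ h => h, fun _ _ h => h⟩
  simp only [PA.setI_I, Function.update_apply]
  split_ifs with hq
  · subst hq; rcases h with h | h <;> rw [h] at h'
    · exact absurd h' (by simp)
    · simp only [Option.some.injEq] at h'; rw [h']
  · exact h'

/-- Setting an unset `L`-premise is an extension. [folklore] -/
theorem Ext.setL (h : σ.L q = none) (k : ℕ) : Ext σ (σ.setL q k) := by
  refine ⟨fun _ _ h => h, fun _ _ h => h, fun _ _ h => h, fun q' k' h' => ?_, fun _ _ h => h⟩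
  simp only [PA.setL_L, Function.update_apply]
  split_ifs with hq
  · subst hq; rw [h] at h'; exact absurd h' (by simp)
  · exact h'

/-- Setting an unset `R`-premise is an extension. [folklore] -/
theorem Ext.setR (h : σ.R q = none) (k : ℕ) : Ext σ (σ.setR q k) := by
  refine ⟨fun _ _ h => h, fun _ _ h => h, fun _ _ h => h, fun _ _ h => h, fun q' k' h' => ?_⟩
  simp only [PA.setR_R, Function.update_apply]
  split_ifs with hq
  · subst hq; rw [h] at h'; exact absurd h' (by simp)
  · exact h'

end Updates

/-! ### Values after an update -/

section EvalUpdates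

variable {P : Params} {σ : PA}

/-- Setting a clause only changes the values of the `D`-variables of that pair. [folklore] -/
theorem PA.eval_setD_of_ne {q : ℕ × ℕ} {C : Finset (ℕ × Bool)} {x : LRefVar}
    (hx : ∀ ℓ b, x ≠ .D q.1 q.2 ℓ b) : (σ.setD q C).eval P x = σ.eval P x := by
  cases x with
  | D i j ℓ b =>
    have hq : (i, j) ≠ q := fun h => hx ℓ b (by rw [← h])
    simp [PA.eval, PA.setD, hq]
  | _ => simp [PA.eval, PA.setD]

/-- Setting a cut variable only changes the values of the `V`-variables of that pair.
[folklore] -/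
theorem PA.eval_setV_of_ne {q : ℕ × ℕ} {k : ℕ} {x : LRefVar} (hx : ∀ ℓ, x ≠ .V q.1 q.2 ℓ) :
    (σ.setV q k).eval P x = σ.eval P x := by
  cases x with
  | V i j ℓ =>
    have hq : (i, j) ≠ q := fun h => hx ℓ (by rw [← h])
    simp [PA.eval, PA.setV, hq]
  | _ => simp [PA.eval, PA.setV]

/-- Setting an `F`-clause only changes the values of the `I`-variables of that position.
[folklore] -/
theorem PA.eval_setI_of_ne {j m : ℕ} {x : LRefVar} (hx : ∀ m', x ≠ .I j m') :
    (σ.setI j m).eval P x = σ.eval P x := by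
  cases x with
  | I j' m' =>
    have hq : j' ≠ j := fun h => hx m' (by rw [← h])
    simp [PA.eval, PA.setI, hq]
  | _ => simp [PA.eval, PA.setI]

/-- Setting an `L`-premise only changes the values of the `L`-variables of that pair.
[folklore] -/
theorem PA.eval_setL_of_ne {q : ℕ × ℕ} {k : ℕ} {x : LRefVar} (hx : ∀ j', x ≠ .L q.1 q.2 j') :
    (σ.setL q k).eval P x = σ.eval P x := by
  cases x with
  | L i j j' =>
    have hq : (i, j) ≠ q := fun h => hx j' (by rw [← h])
    simp [PA.eval, PA.setL, hq]
  | _ => simp [PA.eval, PA.setL]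

/-- Setting an `R`-premise only changes the values of the `R`-variables of that pair.
[folklore] -/
theorem PA.eval_setR_of_ne {q : ℕ × ℕ} {k : ℕ} {x : LRefVar} (hx : ∀ j', x ≠ .R q.1 q.2 j') :
    (σ.setR q k).eval P x = σ.eval P x := by
  cases x with
  | R i j j' =>
    have hq : (i, j) ≠ q := fun h => hx j' (by rw [← h])
    simp [PA.eval, PA.setR, hq]
  | _ => simp [PA.eval, PA.setR]

variable {E : Finset (Literal ℕ)}

/-- `Falsi` is preserved by restriction of the assignment. [folklore] -/
theorem Falsi.anti {τ : PA} (h : Falsi P σ E) (hτσ : Ext τ σ) : Falsi P τ E :=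
  fun x b hx hv => h x b hx (hτσ.eval_eq hv)

/-- Setting the clause of a pair that is not `D`-mentioned keeps `Falsi`.
[cite: Garlik2019, proof of Lemma 19, Case 2] -/
theorem Falsi.setD (h : Falsi P σ E) {i j : ℕ} (hnm : ¬ DMen P E i j) (C : Finset (ℕ × Bool)) :
    Falsi P (σ.setD (i, j) C) E := by
  intro x b hx
  by_cases hxD : ∃ ℓ b', x = .D i j ℓ b'
  · obtain ⟨ℓ, b', rfl⟩ := hxD
    intro hv
    obtain ⟨hi, hj, hℓ, -⟩ := PA.eval_D_isSome hv
    exact hnm ⟨hi, hj, ℓ, hℓ, b', b, hx⟩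
  · push Not at hxD
    rw [PA.eval_setD_of_ne (q := (i, j)) hxD]
    exact h x b hx

/-- Setting the cut variable of a pair without negative `V`-literals to an index whose positive
literal is absent keeps `Falsi`. [cite: Garlik2019, proof of Lemma 19, Case 1] -/
theorem Falsi.setV (h : Falsi P σ E) {i j k : ℕ} (hneg : ¬ HasNeg E (fun ℓ => .V i j ℓ) P.n)
    (hpos : ((LRefVar.V i j k).code, true) ∉ E) : Falsi P (σ.setV (i, j) k) E := by
  intro x b hx
  by_cases hxV : ∃ ℓ, x = .V i j ℓ
  · obtain ⟨ℓ, rfl⟩ := hxV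
    intro hv
    obtain ⟨-, -, -, hℓ, k', hk', hval⟩ := PA.eval_V_isSome hv
    simp only [PA.setV_V, Function.update_self, Option.some.injEq] at hk'
    subst hk'
    subst hval
    by_cases hkℓ : k = ℓ
    · subst hkℓ
      exact hpos (by simpa using hx)
    · exact hneg ⟨ℓ, hℓ, by simpa [decide_eq_false hkℓ] using hx⟩
  · push Not at hxV
    rw [PA.eval_setV_of_ne (q := (i, j)) hxV]
    exact h x b hx

/-- Setting the `F`-clause of a position without negative `I`-literals to an index whose
positive literal is absent keeps `Falsi`. [cite: Garlik2019, proof of Lemma 19, Case 1] -/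
theorem Falsi.setI (h : Falsi P σ E) {j m : ℕ} (hneg : ¬ HasNeg E (fun m' => .I j m') P.r)
    (hpos : ((LRefVar.I j m).code, true) ∉ E) : Falsi P (σ.setI j m) E := by
  intro x b hx
  by_cases hxI : ∃ m', x = .I j m'
  · obtain ⟨m', rfl⟩ := hxI
    intro hv
    obtain ⟨-, hm', k', hk', hval⟩ := PA.eval_I_isSome hv
    simp only [PA.setI_I, Function.update_self, Option.some.injEq] at hk'
    subst hk'
    subst hval
    by_cases hkm : m = m'
    · subst hkm
      exact hpos (by simpa using hx)
    · exact hneg ⟨m', hm', by simpa [decide_eq_false hkm] using hx⟩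
  · push Not at hxI
    rw [PA.eval_setI_of_ne hxI]
    exact h x b hx

/-- Setting the `L`-premise of a pair without negative `L`-literals to a position whose
positive literal is absent keeps `Falsi`. [cite: Garlik2019, proof of Lemma 19, Case 3] -/
theorem Falsi.setL (h : Falsi P σ E) {i j k : ℕ} (hneg : ¬ HasNeg E (fun j' => .L i j j') P.t)
    (hpos : ((LRefVar.L i j k).code, true) ∉ E) : Falsi P (σ.setL (i, j) k) E := by
  intro x b hx
  by_cases hxL : ∃ j', x = .L i j j'
  · obtain ⟨j', rfl⟩ := hxL
    intro hv
    obtain ⟨-, -, -, hj', k', hk', hval⟩ := PA.eval_L_isSome hv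
    simp only [PA.setL_L, Function.update_self, Option.some.injEq] at hk'
    subst hk'
    subst hval
    by_cases hkj : k = j'
    · subst hkj
      exact hpos (by simpa using hx)
    · exact hneg ⟨j', hj', by simpa [decide_eq_false hkj] using hx⟩
  · push Not at hxL
    rw [PA.eval_setL_of_ne (q := (i, j)) hxL]
    exact h x b hx

/-- Setting the `R`-premise of a pair without negative `R`-literals to a position whose
positive literal is absent keeps `Falsi`. [cite: Garlik2019, proof of Lemma 19, Case 3] -/
theorem Falsi.setR (h : Falsi P σ E) {i j k : ℕ} (hneg : ¬ HasNeg E (fun j' => .R i j j') P.t)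
    (hpos : ((LRefVar.R i j k).code, true) ∉ E) : Falsi P (σ.setR (i, j) k) E := by
  intro x b hx
  by_cases hxR : ∃ j', x = .R i j j'
  · obtain ⟨j', rfl⟩ := hxR
    intro hv
    obtain ⟨-, -, -, hj', k', hk', hval⟩ := PA.eval_R_isSome hv
    simp only [PA.setR_R, Function.update_self, Option.some.injEq] at hk'
    subst hk'
    subst hval
    by_cases hkj : k = j'
    · subst hkj
      exact hpos (by simpa using hx)
    · exact hneg ⟨j', hj', by simpa [decide_eq_false hkj] using hx⟩
  · push Not at hxR
    rw [PA.eval_setR_of_ne (q := (i, j)) hxR]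
    exact h x b hx

end EvalUpdates

/-! ### Admissibility of elementary extensions -/

section AdmissibleUpdates

variable {P : Params} {Fc : ℕ → Finset (ℕ × Bool)} {σ : PA}

/-- Admissibility is inherited by a restriction satisfying the structural conditions (C2) and
(C3) (all other conditions only constrain set values). Used for the cleanup.
[cite: Garlik2019, proof of Lemma 19 ("the remaining conditions cannot turn from being true to
false by unassigning variables")] -/
theorem Admissible.of_ext {τ : PA} (hσ : Admissible P Fc σ) (hτσ : Ext τ σ)
    (hLD : ∀ p j k, τ.L (p + 1, j) = some k → τ.D (p + 1, j) ≠ none ∧ τ.D (p, k) ≠ none)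
    (hRD : ∀ p j k, τ.R (p + 1, j) = some k → τ.D (p + 1, j) ≠ none ∧ τ.D (p, k) ≠ none)
    (hDV : ∀ p j, τ.D (p + 1, j) ≠ none → τ.V (p + 1, j) ≠ none)
    (hDI : ∀ j, τ.D (0, j) ≠ none → τ.I j ≠ none) : Admissible P Fc τ where
  D_range i j C h := hσ.D_range i j C (hτσ.D _ _ h)
  V_range i j k h := hσ.V_range i j k (hτσ.V _ _ h)
  I_range j k h := hσ.I_range j k (hτσ.I _ _ h)
  L_range i j k h := hσ.L_range i j k (hτσ.L _ _ h)
  R_range i j k h := hσ.R_range i j k (hτσ.R _ _ h)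
  L_D := hLD
  R_D := hRD
  D_V := hDV
  D_I := hDI
  D_nonTaut i j C h := hσ.D_nonTaut i j C (hτσ.D _ _ h)
  D_card i j C h := hσ.D_card i j C (hτσ.D _ _ h)
  D_cut i j C k h1 h2 h3 := hσ.D_cut i j C k (hτσ.D _ _ h1) h2 (hτσ.V _ _ h3)
  D_last i j C h1 h2 h3 := hσ.D_last i j C h1 h2 (hτσ.D _ _ h3)
  D_F j C m h1 h2 := hσ.D_F j C m (hτσ.D _ _ h1) (hτσ.I _ _ h2)
  L_cut p j k ℓ C' h1 h2 h3 := hσ.L_cut p j k ℓ C' (hτσ.L _ _ h1) (hτσ.V _ _ h2) (hτσ.D _ _ h3)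
  R_cut p j k ℓ C' h1 h2 h3 := hσ.R_cut p j k ℓ C' (hτσ.R _ _ h1) (hτσ.V _ _ h2) (hτσ.D _ _ h3)
  L_keep p j k ℓ C C' h1 h2 h3 h4 :=
    hσ.L_keep p j k ℓ C C' (hτσ.L _ _ h1) (hτσ.V _ _ h2) (hτσ.D _ _ h3) (hτσ.D _ _ h4)
  R_keep p j k ℓ C C' h1 h2 h3 h4 :=
    hσ.R_keep p j k ℓ C C' (hτσ.R _ _ h1) (hτσ.V _ _ h2) (hτσ.D _ _ h3) (hτσ.D _ _ h4)
  inj_LL i j₁ j₂ k h1 h2 := hσ.inj_LL i j₁ j₂ k (hτσ.L _ _ h1) (hτσ.L _ _ h2)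
  inj_RR i j₁ j₂ k h1 h2 := hσ.inj_RR i j₁ j₂ k (hτσ.R _ _ h1) (hτσ.R _ _ h2)
  inj_LR i j₁ j₂ k h1 h2 := hσ.inj_LR i j₁ j₂ k (hτσ.L _ _ h1) (hτσ.R _ _ h2)

/-- A pair whose clause is unset is not the premise of anything. [folklore] -/
theorem Admissible.not_target {p k : ℕ} (hσ : Admissible P Fc σ) (hD : σ.D (p, k) = none)
    (j : ℕ) : σ.L (p + 1, j) ≠ some k ∧ σ.R (p + 1, j) ≠ some k :=
  ⟨fun h => (hσ.L_D p j k h).2 hD, fun h => (hσ.R_D p j k h).2 hD⟩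

/-- A pair whose clause is unset has no premises. [folklore] -/
theorem Admissible.LR_none {p j : ℕ} (hσ : Admissible P Fc σ) (hD : σ.D (p + 1, j) = none) :
    σ.L (p + 1, j) = none ∧ σ.R (p + 1, j) = none := by
  constructor
  · cases h : σ.L (p + 1, j) with
    | none => rfl
    | some k => exact absurd hD (hσ.L_D p j k h).1
  · cases h : σ.R (p + 1, j) with
    | none => rfl
    | some k => exact absurd hD (hσ.R_D p j k h).1

/-- **Setting a cut variable** [Garlík 2019, Lemma 19, Case 1]: at a pair of level `≥ 1` whose
clause is unset, any in-range cut variable may be set. [cite: Garlik2019, Lemma 19 (Case 1)] -/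
theorem Admissible.setV {p j ℓ : ℕ} (hσ : Admissible P Fc σ) (hD : σ.D (p + 1, j) = none)
    (hp : p + 1 < P.s) (hj : j < P.t) (hℓ : ℓ < P.n) : Admissible P Fc (σ.setV (p + 1, j) ℓ) :=
  { hσ with
    V_range := by
      intro i j' k h
      simp only [PA.setV_V, Function.update_apply] at h
      split_ifs at h with hq
      · simp only [Prod.mk.injEq] at hq; obtain ⟨rfl, rfl⟩ := hq
        simp only [Option.some.injEq] at h; subst h
        exact ⟨by omega, hp, hj, hℓ⟩
      · exact hσ.V_range i j' k h
    D_V := by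
      intro p' j' h
      simp only [PA.setV_V, Function.update_apply]
      split_ifs with hq
      · simp
      · exact hσ.D_V p' j' h
    D_cut := by
      intro i j' C k h1 h2 h3
      simp only [PA.setV_V, Function.update_apply] at h3
      split_ifs at h3 with hq
      · simp only [Prod.mk.injEq] at hq; obtain ⟨rfl, rfl⟩ := hq
        simp only [PA.setV_D] at h1; rw [hD] at h1; exact absurd h1 (by simp)
      · exact hσ.D_cut i j' C k h1 h2 h3
    L_cut := by
      intro p' j' k ℓ' C' h1 h2 h3
      simp only [PA.setV_V, Function.update_apply] at h2
      split_ifs at h2 with hq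
      · cases hq
        exact absurd hD (hσ.L_D _ _ _ h1).1
      · exact hσ.L_cut p' j' k ℓ' C' h1 h2 h3
    R_cut := by
      intro p' j' k ℓ' C' h1 h2 h3
      simp only [PA.setV_V, Function.update_apply] at h2
      split_ifs at h2 with hq
      · cases hq
        exact absurd hD (hσ.R_D _ _ _ h1).1
      · exact hσ.R_cut p' j' k ℓ' C' h1 h2 h3
    L_keep := by
      intro p' j' k ℓ' C C' h1 h2 h3 h4
      simp only [PA.setV_V, Function.update_apply] at h2
      split_ifs at h2 with hq
      · cases hq
        exact absurd h3 (by simp [hD])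
      · exact hσ.L_keep p' j' k ℓ' C C' h1 h2 h3 h4
    R_keep := by
      intro p' j' k ℓ' C C' h1 h2 h3 h4
      simp only [PA.setV_V, Function.update_apply] at h2
      split_ifs at h2 with hq
      · cases hq
        exact absurd h3 (by simp [hD])
      · exact hσ.R_keep p' j' k ℓ' C C' h1 h2 h3 h4 }

/-- **Setting an `F`-clause index** [Garlík 2019, Lemma 19, Case 1]: at a level-`0` position
whose clause is unset, any in-range clause index may be set. [cite: Garlik2019, Lemma 19
(Case 1)] -/
theorem Admissible.setI {j m : ℕ} (hσ : Admissible P Fc σ) (hD : σ.D (0, j) = none)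
    (hj : j < P.t) (hm : m < P.r) : Admissible P Fc (σ.setI j m) :=
  { hσ with
    I_range := by
      intro j' k h
      simp only [PA.setI_I, Function.update_apply] at h
      split_ifs at h with hq
      · subst hq; simp only [Option.some.injEq] at h; subst h; exact ⟨hj, hm⟩
      · exact hσ.I_range j' k h
    D_I := by
      intro j' h
      simp only [PA.setI_I, Function.update_apply]
      split_ifs with hq
      · simp
      · exact hσ.D_I j' h
    D_F := by
      intro j' C m' h1 h2
      simp only [PA.setI_I, Function.update_apply] at h2
      split_ifs at h2 with hq
      · subst hq; simp only [PA.setI_D] at h1; rw [hD] at h1; exact absurd h1 (by simp)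
      · exact hσ.D_F j' C m' h1 h2 }

/-- **Setting a clause on a level `≥ 1`** [Garlík 2019, Lemma 19, Case 2]: at a pair whose
clause is unset and whose cut variable is set, one may set a full clause (or the empty clause
at the last pair). [cite: Garlik2019, Lemma 19 (Case 2)] -/
theorem Admissible.setD_succ {p j : ℕ} {C : Finset (ℕ × Bool)} (hσ : Admissible P Fc σ)
    (hD : σ.D (p + 1, j) = none) (hV : σ.V (p + 1, j) ≠ none) (hp : p + 1 < P.s) (hj : j < P.t)
    (hC : (IsFullCl P.n C ∧ ¬ (p + 2 = P.s ∧ j + 1 = P.t)) ∨ (C = ∅ ∧ p + 2 = P.s ∧ j + 1 = P.t)) :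
    Admissible P Fc (σ.setD (p + 1, j) C) := by
  have hLR := hσ.LR_none hD
  have hCr : InRange P.n C := by
    rcases hC with ⟨h, -⟩ | ⟨rfl, -⟩
    · exact h.1
    · intro q hq; simp at hq
  have hCnt : NonTaut C := by
    rcases hC with ⟨h, -⟩ | ⟨rfl, -⟩
    · exact h.2.1
    · intro ℓ h; simp at h
  -- `D` only grows
  have grow : ∀ q, σ.D q ≠ none → Function.update σ.D (p + 1, j) (some C) q ≠ none := by
    intro q hq
    simp only [Function.update_apply]
    split_ifs
    · simp
    · exact hq
  -- a set `D` of the new assignment at a pair other than `(p+1, j)` is old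
  have old : ∀ q C', Function.update σ.D (p + 1, j) (some C) q = some C' → q ≠ (p + 1, j) →
      σ.D q = some C' := by
    intro q C' h hq
    simpa [Function.update_apply, hq] using h
  exact
  { hσ with
    D_range := by
      intro i j' C' h
      simp only [PA.setD_D, Function.update_apply] at h
      split_ifs at h with hq
      · simp only [Prod.mk.injEq] at hq; obtain ⟨rfl, rfl⟩ := hq
        simp only [Option.some.injEq] at h; subst h
        exact ⟨hp, hj, hCr⟩
      · exact hσ.D_range i j' C' h
    L_D := fun p' j' k h => ⟨grow _ (hσ.L_D p' j' k h).1, grow _ (hσ.L_D p' j' k h).2⟩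
    R_D := fun p' j' k h => ⟨grow _ (hσ.R_D p' j' k h).1, grow _ (hσ.R_D p' j' k h).2⟩
    D_V := by
      intro p' j' h
      simp only [PA.setD_D, Function.update_apply] at h
      split_ifs at h with hq
      · cases hq
        exact hV
      · exact hσ.D_V p' j' h
    D_I := by
      intro j' h
      simp only [PA.setD_D, Function.update_apply] at h
      split_ifs at h with hq
      · simp at hq
      · exact hσ.D_I j' h
    D_nonTaut := by
      intro i j' C' h
      simp only [PA.setD_D, Function.update_apply] at h
      split_ifs at h with hq
      · simp only [Option.some.injEq] at h; subst h; exact hCnt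
      · exact hσ.D_nonTaut i j' C' h
    D_card := by
      intro i j' C' h hlt
      simp only [PA.setD_D, Function.update_apply] at h
      split_ifs at h with hq
      · simp only [Prod.mk.injEq] at hq; obtain ⟨rfl, rfl⟩ := hq
        simp only [Option.some.injEq] at h; subst h
        rcases hC with ⟨hf, -⟩ | ⟨rfl, hs, -⟩
        · rw [hf.card_eq] at hlt; exact absurd hlt (lt_irrefl _)
        · simp; omega
      · exact hσ.D_card i j' C' h hlt
    D_cut := by
      intro i j' C' k h hlt hk
      simp only [PA.setD_D, Function.update_apply] at h
      split_ifs at h with hq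
      · simp only [Prod.mk.injEq] at hq; obtain ⟨rfl, rfl⟩ := hq
        simp only [Option.some.injEq] at h; subst h
        rcases hC with ⟨hf, -⟩ | ⟨rfl, -⟩
        · rw [hf.card_eq] at hlt; exact absurd hlt (lt_irrefl _)
        · simp
      · exact hσ.D_cut i j' C' k h hlt hk
    D_last := by
      intro i j' C' hi hj' h
      simp only [PA.setD_D, Function.update_apply] at h
      split_ifs at h with hq
      · simp only [Prod.mk.injEq] at hq; obtain ⟨rfl, rfl⟩ := hq
        simp only [Option.some.injEq] at h; subst h
        rcases hC with ⟨-, hnl⟩ | ⟨rfl, -⟩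
        · exact absurd ⟨by omega, hj'⟩ hnl
        · rfl
      · exact hσ.D_last i j' C' hi hj' h
    D_F := by
      intro j' C' m h1 h2
      exact hσ.D_F j' C' m (old _ _ h1 (by simp)) h2
    L_cut := by
      intro p' j' k ℓ C' h1 h2 h3
      refine hσ.L_cut p' j' k ℓ C' h1 h2 (old _ _ h3 fun hq => ?_)
      simp only [Prod.mk.injEq] at hq
      obtain ⟨rfl, rfl⟩ := hq
      exact (hσ.not_target hD j').1 h1
    R_cut := by
      intro p' j' k ℓ C' h1 h2 h3
      refine hσ.R_cut p' j' k ℓ C' h1 h2 (old _ _ h3 fun hq => ?_)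
      simp only [Prod.mk.injEq] at hq
      obtain ⟨rfl, rfl⟩ := hq
      exact (hσ.not_target hD j').2 h1
    L_keep := by
      intro p' j' k ℓ C₀ C' h1 h2 h3 h4
      refine hσ.L_keep p' j' k ℓ C₀ C' h1 h2 (old _ _ h3 fun hq => ?_) (old _ _ h4 fun hq => ?_)
      · cases hq
        exact absurd (hLR.1.symm.trans h1) (by simp)
      · simp only [Prod.mk.injEq] at hq
        obtain ⟨rfl, rfl⟩ := hq
        exact (hσ.not_target hD j').1 h1
    R_keep := by
      intro p' j' k ℓ C₀ C' h1 h2 h3 h4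
      refine hσ.R_keep p' j' k ℓ C₀ C' h1 h2 (old _ _ h3 fun hq => ?_) (old _ _ h4 fun hq => ?_)
      · cases hq
        exact absurd (hLR.2.symm.trans h1) (by simp)
      · simp only [Prod.mk.injEq] at hq
        obtain ⟨rfl, rfl⟩ := hq
        exact (hσ.not_target hD j').2 h1 }

/-- **Setting a clause on level `0`** [Garlík 2019, Lemma 19, Case 2]: at a level-`0` position
whose clause is unset and whose `F`-clause index is set to `m`, one may set a full clause
containing `C_m` (level `0` is not the last level). [cite: Garlik2019, Lemma 19 (Case 2)] -/
theorem Admissible.setD_zero {j m : ℕ} {C : Finset (ℕ × Bool)} (hσ : Admissible P Fc σ)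
    (hD : σ.D (0, j) = none) (hI : σ.I j = some m) (hs : 1 < P.s) (hj : j < P.t)
    (hC : IsFullCl P.n C) (hFC : Fc m ⊆ C) : Admissible P Fc (σ.setD (0, j) C) := by
  have grow : ∀ q, σ.D q ≠ none → Function.update σ.D (0, j) (some C) q ≠ none := by
    intro q hq
    simp only [Function.update_apply]
    split_ifs
    · simp
    · exact hq
  have old : ∀ q C', Function.update σ.D (0, j) (some C) q = some C' → q ≠ (0, j) →
      σ.D q = some C' := by
    intro q C' h hq
    simpa [Function.update_apply, hq] using h
  exact
  { hσ with
    D_range := by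
      intro i j' C' h
      simp only [PA.setD_D, Function.update_apply] at h
      split_ifs at h with hq
      · simp only [Prod.mk.injEq] at hq; obtain ⟨rfl, rfl⟩ := hq
        simp only [Option.some.injEq] at h; subst h
        exact ⟨by omega, hj, hC.1⟩
      · exact hσ.D_range i j' C' h
    L_D := fun p' j' k h => ⟨grow _ (hσ.L_D p' j' k h).1, grow _ (hσ.L_D p' j' k h).2⟩
    R_D := fun p' j' k h => ⟨grow _ (hσ.R_D p' j' k h).1, grow _ (hσ.R_D p' j' k h).2⟩
    D_V := by
      intro p' j' h
      exact hσ.D_V p' j' (by simpa [Function.update_apply] using h)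
    D_I := by
      intro j' h
      simp only [PA.setD_D, Function.update_apply] at h
      split_ifs at h with hq
      · simp only [Prod.mk.injEq, true_and] at hq; subst hq
        show σ.I _ ≠ none
        rw [hI]; simp
      · exact hσ.D_I j' h
    D_nonTaut := by
      intro i j' C' h
      simp only [PA.setD_D, Function.update_apply] at h
      split_ifs at h with hq
      · simp only [Option.some.injEq] at h; subst h; exact hC.2.1
      · exact hσ.D_nonTaut i j' C' h
    D_card := by
      intro i j' C' h hlt
      simp only [PA.setD_D, Function.update_apply] at h
      split_ifs at h with hq
      · simp only [Option.some.injEq] at h; subst h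
        rw [hC.card_eq] at hlt; exact absurd hlt (lt_irrefl _)
      · exact hσ.D_card i j' C' h hlt
    D_cut := by
      intro i j' C' k h hlt hk
      simp only [PA.setD_D, Function.update_apply] at h
      split_ifs at h with hq
      · simp only [Option.some.injEq] at h; subst h
        rw [hC.card_eq] at hlt; exact absurd hlt (lt_irrefl _)
      · exact hσ.D_cut i j' C' k h hlt hk
    D_last := by
      intro i j' C' hi hj' h
      simp only [PA.setD_D, Function.update_apply] at h
      split_ifs at h with hq
      · simp only [Prod.mk.injEq] at hq; omega
      · exact hσ.D_last i j' C' hi hj' h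
    D_F := by
      intro j' C' m' h1 h2
      simp only [PA.setD_D, Function.update_apply] at h1
      split_ifs at h1 with hq
      · simp only [Prod.mk.injEq, true_and] at hq; subst hq
        simp only [Option.some.injEq] at h1; subst h1
        change σ.I _ = some m' at h2
        rw [hI] at h2; simp only [Option.some.injEq] at h2; subst h2
        exact hFC
      · exact hσ.D_F j' C' m' h1 h2
    L_cut := by
      intro p' j' k ℓ C' h1 h2 h3
      refine hσ.L_cut p' j' k ℓ C' h1 h2 (old _ _ h3 fun hq => ?_)
      simp only [Prod.mk.injEq] at hq
      obtain ⟨rfl, rfl⟩ := hq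
      exact (hσ.not_target hD j').1 h1
    R_cut := by
      intro p' j' k ℓ C' h1 h2 h3
      refine hσ.R_cut p' j' k ℓ C' h1 h2 (old _ _ h3 fun hq => ?_)
      simp only [Prod.mk.injEq] at hq
      obtain ⟨rfl, rfl⟩ := hq
      exact (hσ.not_target hD j').2 h1
    L_keep := by
      intro p' j' k ℓ C₀ C' h1 h2 h3 h4
      refine hσ.L_keep p' j' k ℓ C₀ C' h1 h2 (old _ _ h3 (by simp)) (old _ _ h4 fun hq => ?_)
      simp only [Prod.mk.injEq] at hq
      obtain ⟨rfl, rfl⟩ := hq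
      exact (hσ.not_target hD j').1 h1
    R_keep := by
      intro p' j' k ℓ C₀ C' h1 h2 h3 h4
      refine hσ.R_keep p' j' k ℓ C₀ C' h1 h2 (old _ _ h3 (by simp)) (old _ _ h4 fun hq => ?_)
      simp only [Prod.mk.injEq] at hq
      obtain ⟨rfl, rfl⟩ := hq
      exact (hσ.not_target hD j').2 h1 }

end AdmissibleUpdates

/-! ### The cleanup `σ ↦ σ₁` -/

section Cleanup

open Classical in
/-- Step 1 of the cleanup [Garlík 2019, proof of Lemma 19]: unset every `L`- (`R`-) premise
not set by `ρ` whose pair is not `L`- (`R`-) important in `E`. [cite: Garlik2019, Lemma 19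
(proof, Step 1)] -/
noncomputable def clean1 (P : Params) (E : Finset (Literal ℕ)) (ρ σ : PA) : PA :=
  { σ with
    L := fun q => if ρ.L q = none ∧ ¬ LImp P E q.1 q.2 then none else σ.L q
    R := fun q => if ρ.R q = none ∧ ¬ RImp P E q.1 q.2 then none else σ.R q }

open Classical in
/-- Step 2 of the cleanup: unset every clause not set by `ρ` whose pair is not `D`-mentioned
in `E` and is incident to no edge (no premise set, premise of nothing).
[cite: Garlik2019, Lemma 19 (proof, Step 2)] -/
noncomputable def clean2 (P : Params) (E : Finset (Literal ℕ)) (ρ σ : PA) : PA :=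
  { σ with
    D := fun q => if ρ.D q = none ∧ ¬ DMen P E q.1 q.2 ∧ σ.L q = none ∧ σ.R q = none ∧
        (∀ j', σ.L (q.1 + 1, j') ≠ some q.2 ∧ σ.R (q.1 + 1, j') ≠ some q.2) then none
      else σ.D q }

open Classical in
/-- Step 3 of the cleanup: unset every cut variable (`F`-clause index) not set by `ρ` whose
pair is not `V`- (`I`-) important in `E` and whose clause is unset.
[cite: Garlik2019, Lemma 19 (proof, Step 3)] -/
noncomputable def clean3 (P : Params) (E : Finset (Literal ℕ)) (ρ σ : PA) : PA :=
  { σ with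
    V := fun q => if ρ.V q = none ∧ ¬ VImp P E q.1 q.2 ∧ σ.D q = none then none else σ.V q
    I := fun j => if ρ.I j = none ∧ ¬ IImp P E j ∧ σ.D (0, j) = none then none else σ.I j }

/-- The cleanup `σ₁` of `σ` [Garlík 2019, proof of Lemma 19]: Steps 1, 2, 3 in this order.
[cite: Garlik2019, Lemma 19 (proof, the three-step cleanup)] -/
noncomputable def clean (P : Params) (E : Finset (Literal ℕ)) (ρ σ : PA) : PA :=
  clean3 P E ρ (clean2 P E ρ (clean1 P E ρ σ))

variable {P : Params} {Fc : ℕ → Finset (ℕ × Bool)} {E : Finset (Literal ℕ)} {ρ σ : PA}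

/-- Step 1 restricts. [folklore] -/
theorem ext_clean1 (P : Params) (E : Finset (Literal ℕ)) (ρ σ : PA) : Ext (clean1 P E ρ σ) σ := by
  refine ⟨fun _ _ h => h, fun _ _ h => h, fun _ _ h => h, fun q k h => ?_, fun q k h => ?_⟩
  · simp only [clean1] at h; split_ifs at h; exact h
  · simp only [clean1] at h; split_ifs at h; exact h

/-- Step 2 restricts. [folklore] -/
theorem ext_clean2 (P : Params) (E : Finset (Literal ℕ)) (ρ σ : PA) : Ext (clean2 P E ρ σ) σ := by
  refine ⟨fun q C h => ?_, fun _ _ h => h, fun _ _ h => h, fun _ _ h => h, fun _ _ h => h⟩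
  simp only [clean2] at h; split_ifs at h; exact h

/-- Step 3 restricts. [folklore] -/
theorem ext_clean3 (P : Params) (E : Finset (Literal ℕ)) (ρ σ : PA) : Ext (clean3 P E ρ σ) σ := by
  refine ⟨fun _ _ h => h, fun q k h => ?_, fun j k h => ?_, fun _ _ h => h, fun _ _ h => h⟩
  · simp only [clean3] at h; split_ifs at h; exact h
  · simp only [clean3] at h; split_ifs at h; exact h

/-- The cleanup restricts: `σ` extends `σ₁`. [cite: Garlik2019, Lemma 19 (proof)] -/
theorem ext_clean (P : Params) (E : Finset (Literal ℕ)) (ρ σ : PA) : Ext (clean P E ρ σ) σ :=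
  ((ext_clean3 P E ρ _).trans (ext_clean2 P E ρ _)).trans (ext_clean1 P E ρ σ)

/-- The cleanup still extends `ρ`. [cite: Garlik2019, Lemma 19 (proof)] -/
theorem Ext.clean (h : Ext ρ σ) : Ext ρ (clean P E ρ σ) := by
  refine ⟨fun q C hq => ?_, fun q k hq => ?_, fun j k hq => ?_, fun q k hq => ?_, fun q k hq => ?_⟩
  · show (clean2 P E ρ (clean1 P E ρ σ)).D q = some C
    simp only [clean2]
    split_ifs with hc
    · exact absurd hc.1 (by rw [hq]; simp)
    · exact h.D q C hq
  · show (clean3 P E ρ _).V q = some k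
    simp only [clean3]
    split_ifs with hc
    · exact absurd hc.1 (by rw [hq]; simp)
    · exact h.V q k hq
  · show (clean3 P E ρ _).I j = some k
    simp only [clean3]
    split_ifs with hc
    · exact absurd hc.1 (by rw [hq]; simp)
    · exact h.I j k hq
  · show (clean1 P E ρ σ).L q = some k
    simp only [clean1]
    split_ifs with hc
    · exact absurd hc.1 (by rw [hq]; simp)
    · exact h.L q k hq
  · show (clean1 P E ρ σ).R q = some k
    simp only [clean1]
    split_ifs with hc
    · exact absurd hc.1 (by rw [hq]; simp)
    · exact h.R q k hq

/-- **The cleanup is admissible.** [cite: Garlik2019, Lemma 19 (proof: "σ', σ'', σ₁ are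
admissible assignments")] -/
theorem Admissible.clean (hσ : Admissible P Fc σ) : Admissible P Fc (clean P E ρ σ) := by
  have back : ∀ q C, (clean2 P E ρ (clean1 P E ρ σ)).D q = some C → σ.D q = some C :=
    fun q C h => (ext_clean1 P E ρ σ).D _ _ ((ext_clean2 P E ρ _).D _ _ h)
  have ne_back : ∀ q, (clean2 P E ρ (clean1 P E ρ σ)).D q ≠ none → σ.D q ≠ none := by
    intro q h h0
    cases hx : (clean2 P E ρ (clean1 P E ρ σ)).D q with
    | none => exact h hx
    | some C => rw [back q C hx] at h0; exact absurd h0 (by simp)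
  refine hσ.of_ext (ext_clean P E ρ σ) ?_ ?_ ?_ ?_
  · -- (C2) for `L`
    intro p j k h
    change (clean1 P E ρ σ).L (p + 1, j) = some k at h
    have hL : σ.L (p + 1, j) = some k := (ext_clean1 P E ρ σ).L _ _ h
    obtain ⟨h1, h2⟩ := hσ.L_D p j k hL
    constructor
    · show (clean2 P E ρ (clean1 P E ρ σ)).D (p + 1, j) ≠ none
      simp only [clean2]
      split_ifs with hc
      · rw [hc.2.2.1] at h; exact absurd h (by simp)
      · exact h1
    · show (clean2 P E ρ (clean1 P E ρ σ)).D (p, k) ≠ none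
      simp only [clean2]
      split_ifs with hc
      · exact absurd h (hc.2.2.2.2 j).1
      · exact h2
  · -- (C2) for `R`
    intro p j k h
    change (clean1 P E ρ σ).R (p + 1, j) = some k at h
    have hR : σ.R (p + 1, j) = some k := (ext_clean1 P E ρ σ).R _ _ h
    obtain ⟨h1, h2⟩ := hσ.R_D p j k hR
    constructor
    · show (clean2 P E ρ (clean1 P E ρ σ)).D (p + 1, j) ≠ none
      simp only [clean2]
      split_ifs with hc
      · rw [hc.2.2.2.1] at h; exact absurd h (by simp)
      · exact h1
    · show (clean2 P E ρ (clean1 P E ρ σ)).D (p, k) ≠ none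
      simp only [clean2]
      split_ifs with hc
      · exact absurd h (hc.2.2.2.2 j).2
      · exact h2
  · -- (C3), level ≥ 1
    intro p j h
    change (clean2 P E ρ (clean1 P E ρ σ)).D (p + 1, j) ≠ none at h
    show (clean3 P E ρ _).V (p + 1, j) ≠ none
    simp only [clean3]
    split_ifs with hc
    · exact absurd hc.2.2 h
    · exact hσ.D_V p j (ne_back _ h)
  · -- (C3), level 0
    intro j h
    change (clean2 P E ρ (clean1 P E ρ σ)).D (0, j) ≠ none at h
    show (clean3 P E ρ _).I j ≠ none
    simp only [clean3]
    split_ifs with hc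
    · exact absurd hc.2.2 h
    · exact hσ.D_I j (ne_back _ h)

/-- **The cleanup stays covered**: important groups are never unset.
[cite: Garlik2019, Lemma 19 (proof: σ₁ satisfies (ii))] -/
theorem Covered.clean (hC : Covered P σ E) : Covered P (clean P E ρ σ) E := by
  refine ⟨fun i j hm => ?_, fun i j hm => ?_, fun j hm => ?_, fun i j hm => ?_, fun i j hm => ?_⟩
  · show (clean2 P E ρ (clean1 P E ρ σ)).D (i, j) ≠ none
    simp only [clean2]
    split_ifs with hc
    · exact absurd hm hc.2.1
    · exact hC.D i j hm
  · show (clean3 P E ρ _).V (i, j) ≠ none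
    simp only [clean3]
    split_ifs with hc
    · exact absurd hm hc.2.1
    · exact hC.V i j hm
  · show (clean3 P E ρ _).I j ≠ none
    simp only [clean3]
    split_ifs with hc
    · exact absurd hm hc.2.1
    · exact hC.I j hm
  · show (clean1 P E ρ σ).L (i, j) ≠ none
    simp only [clean1]
    split_ifs with hc
    · exact absurd hm hc.2
    · exact hC.L i j hm
  · show (clean1 P E ρ σ).R (i, j) ≠ none
    simp only [clean1]
    split_ifs with hc
    · exact absurd hm hc.2
    · exact hC.R i j hm

/-- `Falsi` survives the cleanup. [cite: Garlik2019, Lemma 19 (proof: σ₁ satisfies (i))] -/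
theorem Falsi.clean (hF : Falsi P σ E) : Falsi P (clean P E ρ σ) E :=
  hF.anti (ext_clean P E ρ σ)

/-! #### Counting the pairs of a level set by the cleanup -/

open Classical in
/-- The positions of level `i` that are `L`-important in `E`. [folklore] -/
noncomputable def impL (P : Params) (E : Finset (Literal ℕ)) (i : ℕ) : Finset ℕ :=
  (Finset.range P.t).filter fun j => LImp P E i j

open Classical in
/-- The positions of level `i` that are `R`-important in `E`. [folklore] -/
noncomputable def impR (P : Params) (E : Finset (Literal ℕ)) (i : ℕ) : Finset ℕ :=
  (Finset.range P.t).filter fun j => RImp P E i j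

open Classical in
/-- The positions of level `i` that are `V`-important in `E`. [folklore] -/
noncomputable def impV (P : Params) (E : Finset (Literal ℕ)) (i : ℕ) : Finset ℕ :=
  (Finset.range P.t).filter fun j => VImp P E i j

open Classical in
/-- The positions of level `0` that are `I`-important in `E`. [folklore] -/
noncomputable def impI (P : Params) (E : Finset (Literal ℕ)) : Finset ℕ :=
  (Finset.range P.t).filter fun j => IImp P E j

open Classical in
/-- The positions of level `i` that are `D`-mentioned in `E`. [folklore] -/
noncomputable def menD (P : Params) (E : Finset (Literal ℕ)) (i : ℕ) : Finset ℕ :=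
  (Finset.range P.t).filter fun j => DMen P E i j

open Classical in
/-- The positions of level `i` whose `L`-premise is set in `σ`. [folklore] -/
noncomputable def slotsL (P : Params) (σ : PA) (i : ℕ) : Finset ℕ :=
  (Finset.range P.t).filter fun j => σ.L (i, j) ≠ none

open Classical in
/-- The positions of level `i` whose `R`-premise is set in `σ`. [folklore] -/
noncomputable def slotsR (P : Params) (σ : PA) (i : ℕ) : Finset ℕ :=
  (Finset.range P.t).filter fun j => σ.R (i, j) ≠ none

/-- The `L`-premises of level `i + 1` (a set of positions of level `i`). [folklore] -/
noncomputable def tgtL (P : Params) (σ : PA) (i : ℕ) : Finset ℕ :=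
  (slotsL P σ (i + 1)).biUnion fun j => (σ.L (i + 1, j)).toFinset

/-- The `R`-premises of level `i + 1` (a set of positions of level `i`). [folklore] -/
noncomputable def tgtR (P : Params) (σ : PA) (i : ℕ) : Finset ℕ :=
  (slotsR P σ (i + 1)).biUnion fun j => (σ.R (i + 1, j)).toFinset

/-- A `biUnion` of sets with at most one element each is no larger than the index set.
[folklore] -/
theorem card_biUnion_toFinset_le (S : Finset ℕ) (f : ℕ → Option ℕ) :
    (S.biUnion fun j => (f j).toFinset).card ≤ S.card := by
  classical
  calc (S.biUnion fun j => (f j).toFinset).card ≤ ∑ j ∈ S, ((f j).toFinset).card :=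
        Finset.card_biUnion_le
    _ ≤ ∑ _j ∈ S, 1 := Finset.sum_le_sum fun j _ => by
        cases f j <;> simp
    _ = S.card := by simp

/-- After Step 1, a set `L`-premise is set by `ρ` or `L`-important. [folklore] -/
theorem slotsL_clean1_subset (i : ℕ) :
    slotsL P (clean1 P E ρ σ) i ⊆ setPairs P ρ i ∪ impL P E i := by
  classical
  intro j hj
  simp only [slotsL, Finset.mem_filter, Finset.mem_range, clean1] at hj
  obtain ⟨hjt, hne⟩ := hj
  simp only [Finset.mem_union, setPairs, impL, Finset.mem_filter, Finset.mem_range]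
  split_ifs at hne with h
  · exact absurd rfl hne
  · rw [not_and_or] at h
    rcases h with h | h
    · exact Or.inl ⟨hjt, Or.inr (Or.inr (Or.inl h))⟩
    · exact Or.inr ⟨hjt, not_not.1 h⟩

/-- After Step 1, a set `R`-premise is set by `ρ` or `R`-important. [folklore] -/
theorem slotsR_clean1_subset (i : ℕ) :
    slotsR P (clean1 P E ρ σ) i ⊆ setPairs P ρ i ∪ impR P E i := by
  classical
  intro j hj
  simp only [slotsR, Finset.mem_filter, Finset.mem_range, clean1] at hj
  obtain ⟨hjt, hne⟩ := hj
  simp only [Finset.mem_union, setPairs, impR, Finset.mem_filter, Finset.mem_range]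
  split_ifs at hne with h
  · exact absurd rfl hne
  · rw [not_and_or] at h
    rcases h with h | h
    · exact Or.inl ⟨hjt, Or.inr (Or.inr (Or.inr (Or.inl h)))⟩
    · exact Or.inr ⟨hjt, not_not.1 h⟩

/-- **The vertex bound after cleanup** (the count `|U_1| ≤ 10pt + 4w` of [Garlík 2019, proof
of Lemma 19, Case 3], here per level): on every level, the cleanup sets groups at at most
`3K + 7W` pairs, where `K` bounds the pairs set by `ρ` per level and `W` the important pairs
of `E` per level and kind. [cite: Garlik2019, Lemma 19 (proof, Case 3, the bound on U_1)] -/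
theorem card_setPairs_clean_le (hσ : Admissible P Fc σ) {K W T : ℕ}
    (hK : LevelSparse P K ρ) (hW : Narrow P W T E) (i : ℕ) :
    (setPairs P (clean P E ρ σ) i).card ≤ 3 * K + 7 * W := by
  classical
  set σ' := clean1 P E ρ σ with hσ'
  set σ'' := clean2 P E ρ σ' with hσ''
  have hsub : setPairs P (clean P E ρ σ) i ⊆
      setPairs P ρ i ∪ impL P E i ∪ impR P E i ∪ menD P E i ∪ tgtL P σ' i ∪ tgtR P σ' i ∪
        impV P E i ∪ impI P E := by
    intro j hj
    simp only [setPairs, Finset.mem_filter, Finset.mem_range] at hj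
    obtain ⟨hjt, hset⟩ := hj
    -- the reasons for a group of `(i, j)` to be set after the cleanup
    have reasonL : σ'.L (i, j) ≠ none → j ∈ setPairs P ρ i ∪ impL P E i := fun h =>
      slotsL_clean1_subset (σ := σ) i
        (by simp only [slotsL, Finset.mem_filter, Finset.mem_range]; exact ⟨hjt, h⟩)
    have reasonR : σ'.R (i, j) ≠ none → j ∈ setPairs P ρ i ∪ impR P E i := fun h =>
      slotsR_clean1_subset (σ := σ) i
        (by simp only [slotsR, Finset.mem_filter, Finset.mem_range]; exact ⟨hjt, h⟩)
    have reasonD : σ''.D (i, j) ≠ none → j ∈ setPairs P ρ i ∪ impL P E i ∪ impR P E i ∪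
        menD P E i ∪ tgtL P σ' i ∪ tgtR P σ' i := by
      intro h
      have h' : (clean2 P E ρ σ').D (i, j) ≠ none := h
      simp only [clean2] at h'
      split_ifs at h' with hc
      · exact absurd rfl h'
      · simp only [not_and_or, not_not, not_forall] at hc
        simp only [Finset.mem_union]
        rcases hc with hc | hc | hc | hc | ⟨j', hc⟩
        · left; left; left; left; left
          simp only [setPairs, Finset.mem_filter, Finset.mem_range]
          exact ⟨hjt, Or.inl hc⟩
        · left; left; right
          simp only [menD, Finset.mem_filter, Finset.mem_range]
          exact ⟨hjt, hc⟩
        · have := reasonL hc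
          simp only [Finset.mem_union] at this
          rcases this with h | h
          · left; left; left; left; left; exact h
          · left; left; left; left; right; exact h
        · have := reasonR hc
          simp only [Finset.mem_union] at this
          rcases this with h | h
          · left; left; left; left; left; exact h
          · left; left; left; right; exact h
        · rcases hc with hc | hc
          · left; right
            simp only [tgtL, Finset.mem_biUnion, slotsL, Finset.mem_filter, Finset.mem_range,
              Option.mem_toFinset, Option.mem_def]
            have hj' : j' < P.t := (hσ.L_range _ _ _ ((ext_clean1 P E ρ σ).L _ _ hc)).2.2.1
            exact ⟨j', ⟨hj', by rw [hc]; simp⟩, hc⟩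
          · right
            simp only [tgtR, Finset.mem_biUnion, slotsR, Finset.mem_filter, Finset.mem_range,
              Option.mem_toFinset, Option.mem_def]
            have hj' : j' < P.t := (hσ.R_range _ _ _ ((ext_clean1 P E ρ σ).R _ _ hc)).2.2.1
            exact ⟨j', ⟨hj', by rw [hc]; simp⟩, hc⟩
    simp only [Finset.mem_union]
    rcases hset with h | h | h | h | ⟨rfl, h⟩
    · -- `D` set after the cleanup = set in `σ''`
      have := reasonD h
      simp only [Finset.mem_union] at this
      left; left; exact this
    · -- `V`
      have h' : (clean3 P E ρ σ'').V (i, j) ≠ none := h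
      simp only [clean3] at h'
      split_ifs at h' with hc
      · exact absurd rfl h'
      · simp only [not_and_or] at hc
        rcases hc with hc | hc | hc
        · left; left; left; left; left; left; left
          simp only [setPairs, Finset.mem_filter, Finset.mem_range]
          exact ⟨hjt, Or.inr (Or.inl hc)⟩
        · left; right
          simp only [impV, Finset.mem_filter, Finset.mem_range]
          exact ⟨hjt, not_not.1 hc⟩
        · have := reasonD hc
          simp only [Finset.mem_union] at this
          left; left; exact this
    · have := reasonL h
      simp only [Finset.mem_union] at this
      rcases this with h | h
      · left; left; left; left; left; left; left; exact h
      · left; left; left; left; left; left; right; exact h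
    · have := reasonR h
      simp only [Finset.mem_union] at this
      rcases this with h | h
      · left; left; left; left; left; left; left; exact h
      · left; left; left; left; left; right; exact h
    · -- `I` (level 0)
      have h' : (clean3 P E ρ σ'').I j ≠ none := h
      simp only [clean3] at h'
      split_ifs at h' with hc
      · exact absurd rfl h'
      · simp only [not_and_or] at hc
        rcases hc with hc | hc | hc
        · left; left; left; left; left; left; left
          simp only [setPairs, Finset.mem_filter, Finset.mem_range]
          exact ⟨hjt, Or.inr (Or.inr (Or.inr (Or.inr ⟨trivial, hc⟩)))⟩
        · right
          simp only [impI, Finset.mem_filter, Finset.mem_range]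
          exact ⟨hjt, not_not.1 hc⟩
        · have := reasonD hc
          simp only [Finset.mem_union] at this
          left; left; exact this
  -- the cardinalities of the eight pieces
  have c1 : (setPairs P ρ i).card ≤ K := hK i
  have c2 : (impL P E i).card ≤ W := hW.limp i
  have c3 : (impR P E i).card ≤ W := hW.rimp i
  have c4 : (menD P E i).card ≤ W := hW.dmen i
  have c5 : (tgtL P σ' i).card ≤ K + W :=
    calc (tgtL P σ' i).card ≤ (slotsL P σ' (i + 1)).card := card_biUnion_toFinset_le _ _
      _ ≤ (setPairs P ρ (i + 1) ∪ impL P E (i + 1)).card :=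
          Finset.card_le_card (slotsL_clean1_subset (i + 1))
      _ ≤ (setPairs P ρ (i + 1)).card + (impL P E (i + 1)).card := Finset.card_union_le _ _
      _ ≤ K + W := Nat.add_le_add (hK _) (hW.limp _)
  have c6 : (tgtR P σ' i).card ≤ K + W :=
    calc (tgtR P σ' i).card ≤ (slotsR P σ' (i + 1)).card := card_biUnion_toFinset_le _ _
      _ ≤ (setPairs P ρ (i + 1) ∪ impR P E (i + 1)).card :=
          Finset.card_le_card (slotsR_clean1_subset (i + 1))
      _ ≤ (setPairs P ρ (i + 1)).card + (impR P E (i + 1)).card := Finset.card_union_le _ _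
      _ ≤ K + W := Nat.add_le_add (hK _) (hW.rimp _)
  have c7 : (impV P E i).card ≤ W := hW.vimp i
  have c8 : (impI P E).card ≤ W := hW.iimp
  calc (setPairs P (clean P E ρ σ) i).card ≤ _ := Finset.card_le_card hsub
    _ ≤ (setPairs P ρ i ∪ impL P E i ∪ impR P E i ∪ menD P E i ∪ tgtL P σ' i ∪
          tgtR P σ' i ∪ impV P E i).card + (impI P E).card := Finset.card_union_le _ _
    _ ≤ (setPairs P ρ i ∪ impL P E i ∪ impR P E i ∪ menD P E i ∪ tgtL P σ' i ∪
          tgtR P σ' i).card + (impV P E i).card + (impI P E).card := by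
        gcongr; exact Finset.card_union_le _ _
    _ ≤ (setPairs P ρ i ∪ impL P E i ∪ impR P E i ∪ menD P E i ∪ tgtL P σ' i).card +
          (tgtR P σ' i).card + (impV P E i).card + (impI P E).card := by
        gcongr; exact Finset.card_union_le _ _
    _ ≤ (setPairs P ρ i ∪ impL P E i ∪ impR P E i ∪ menD P E i).card + (tgtL P σ' i).card +
          (tgtR P σ' i).card + (impV P E i).card + (impI P E).card := by
        gcongr; exact Finset.card_union_le _ _
    _ ≤ (setPairs P ρ i ∪ impL P E i ∪ impR P E i).card + (menD P E i).card +
          (tgtL P σ' i).card + (tgtR P σ' i).card + (impV P E i).card + (impI P E).card := by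
        gcongr; exact Finset.card_union_le _ _
    _ ≤ (setPairs P ρ i ∪ impL P E i).card + (impR P E i).card + (menD P E i).card +
          (tgtL P σ' i).card + (tgtR P σ' i).card + (impV P E i).card + (impI P E).card := by
        gcongr; exact Finset.card_union_le _ _
    _ ≤ (setPairs P ρ i).card + (impL P E i).card + (impR P E i).card + (menD P E i).card +
          (tgtL P σ' i).card + (tgtR P σ' i).card + (impV P E i).card + (impI P E).card := by
        gcongr; exact Finset.card_union_le _ _
    _ ≤ K + W + W + W + (K + W) + (K + W) + W + W := by gcongr
    _ = 3 * K + 7 * W := by ring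

end Cleanup

/-! ### The standing hypotheses of the deterministic argument -/

/-- The hypotheses on the parameters and on the clauses `C_m = Fc m` of `F` under which the
adversary argument runs: `n ≥ 1`, `s ≥ n + 1`, `t ≥ s` ([Garlík 2019, Thm 7, (7)]), the
clauses of `F` are non-tautological clauses over `x_0, …, x_{n-1}`, and `F` is unsatisfiable in
the form "every full clause is a weakening of some `C_m`". [cite: Garlik2019, Thm 7
(hypotheses (7))] -/
structure CoreHyp (P : Params) (Fc : ℕ → Finset (ℕ × Bool)) : Prop where
  /-- `n ≥ 1` -/
  one_le_n : 1 ≤ P.n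
  /-- `s ≥ n + 1` -/
  n_lt_s : P.n + 1 ≤ P.s
  /-- `t ≥ s` -/
  s_le_t : P.s ≤ P.t
  /-- the clauses of `F` use the variables `x_0, …, x_{n-1}` -/
  Fc_range : ∀ m < P.r, InRange P.n (Fc m)
  /-- the clauses of `F` are non-tautological -/
  Fc_nonTaut : ∀ m < P.r, NonTaut (Fc m)
  /-- `F` is unsatisfiable: every full clause is a weakening of a clause of `F` -/
  Fc_unsat : ∀ c : ℕ → Bool, ∃ m < P.r, Fc m ⊆ (Finset.range P.n).image fun ℓ => (ℓ, c ℓ)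

/-- `1 < s`. [folklore] -/
theorem CoreHyp.one_lt_s {P : Params} {Fc : ℕ → Finset (ℕ × Bool)} (h : CoreHyp P Fc) :
    1 < P.s := by
  have := h.one_le_n; have := h.n_lt_s; omega

/-- Every full clause is a weakening of some clause of `F` (unsatisfiability of `F`).
[cite: Garlik2019, Lemma 19 (proof, Case 3: "Pick some m ∈ [r] such that the clause C_m of F
is a subset of (C_{2,j} ∖ {¬x_ℓ}) ∪ {x_ℓ}")] -/
theorem CoreHyp.exists_Fc_subset {P : Params} {Fc : ℕ → Finset (ℕ × Bool)} (hP : CoreHyp P Fc)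
    {C : Finset (ℕ × Bool)}
    (hC : IsFullCl P.n C) : ∃ m < P.r, Fc m ⊆ C := by
  classical
  obtain ⟨m, hm, hsub⟩ := hP.Fc_unsat fun ℓ => decide ((ℓ, true) ∈ C)
  refine ⟨m, hm, hsub.trans fun q hq => ?_⟩
  obtain ⟨ℓ, hℓ, rfl⟩ := Finset.mem_image.1 hq
  rw [Finset.mem_range] at hℓ
  by_cases h : (ℓ, true) ∈ C
  · simp [h]
  · have h' : (ℓ, false) ∈ C := (hC.2.2 ℓ hℓ).resolve_left h
    simpa [h] using h'

/-! ### Filling the clause of a pair (Case 2) -/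

section Fill

variable {P : Params} {Fc : ℕ → Finset (ℕ × Bool)} {E : Finset (Literal ℕ)} {σ : PA}

/-- Two assignments agreeing on a level set groups at the same pairs of that level.
[folklore] -/
theorem setPairs_congr {τ σ : PA} {i : ℕ}
    (h : ∀ j, τ.D (i, j) = σ.D (i, j) ∧ τ.V (i, j) = σ.V (i, j) ∧ τ.L (i, j) = σ.L (i, j) ∧
      τ.R (i, j) = σ.R (i, j) ∧ (i = 0 → τ.I j = σ.I j)) :
    setPairs P τ i = setPairs P σ i := by
  classical
  unfold setPairs
  apply Finset.filter_congr
  intro j _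
  obtain ⟨h1, h2, h3, h4, h5⟩ := h j
  rw [h1, h2, h3, h4]
  by_cases hi : i = 0
  · rw [h5 hi]
  · simp [hi]

/-- A pair with an unset group of some kind that is covered is not important of that kind;
for `V`: fewer than `n/2` positive and no negative `V`-literals. [folklore] -/
theorem Covered.not_VImp (hC : Covered P σ E) {i j : ℕ} (hV : σ.V (i, j) = none) :
    ¬ VImp P E i j := fun h => hC.V i j h hV

/-- As `Covered.not_VImp`, for `I`. [folklore] -/
theorem Covered.not_IImp (hC : Covered P σ E) {j : ℕ} (hI : σ.I j = none) : ¬ IImp P E j :=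
  fun h => hC.I j h hI

/-- As `Covered.not_VImp`, for `L`. [folklore] -/
theorem Covered.not_LImp (hC : Covered P σ E) {i j : ℕ} (hL : σ.L (i, j) = none) :
    ¬ LImp P E i j := fun h => hC.L i j h hL

/-- As `Covered.not_VImp`, for `R`. [folklore] -/
theorem Covered.not_RImp (hC : Covered P σ E) {i j : ℕ} (hR : σ.R (i, j) = none) :
    ¬ RImp P E i j := fun h => hC.R i j h hR

/-- As `Covered.not_VImp`, for `D`. [folklore] -/
theorem Covered.not_DMen (hC : Covered P σ E) {i j : ℕ} (hD : σ.D (i, j) = none) :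
    ¬ DMen P E i j := fun h => hC.D i j h hD

/-- A free cut variable for a pair of level `≥ 1` that is not `V`-important: no negative
`V`-literal in `E` and some `ℓ < n` whose positive literal is absent.
[cite: Garlik2019, Lemma 19 (proof, Case 1: "there are more than n/2 available values")] -/
theorem exists_free_V {i j : ℕ} (hn : 1 ≤ P.n) (h1 : 1 ≤ i) (hi : i < P.s) (hj : j < P.t)
    (hnv : ¬ VImp P E i j) :
    ¬ HasNeg E (fun ℓ => .V i j ℓ) P.n ∧ ∃ ℓ < P.n, ((LRefVar.V i j ℓ).code, true) ∉ E := by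
  simp only [VImp, not_and, not_or, not_le] at hnv
  obtain ⟨hneg, hpos⟩ := hnv h1 hi hj
  have : posCnt E (fun ℓ => LRefVar.V i j ℓ) P.n < P.n := by omega
  exact ⟨hneg, exists_pos_not_mem this⟩

/-- A free clause index for a level-`0` position that is not `I`-important.
[cite: Garlik2019, Lemma 19 (proof, Case 1: "more than r/2 available values")] -/
theorem exists_free_I {j : ℕ} (hj : j < P.t) (hni : ¬ IImp P E j) :
    ¬ HasNeg E (fun m => .I j m) P.r ∧ ∃ m < P.r, ((LRefVar.I j m).code, true) ∉ E := by
  simp only [IImp, not_and, not_or, not_le] at hni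
  obtain ⟨hneg, hpos⟩ := hni hj
  have : posCnt E (fun m => LRefVar.I j m) P.r < P.r := by omega
  exact ⟨hneg, exists_pos_not_mem this⟩

/-- `r ≥ 1` under the standing hypotheses (the all-false assignment is falsified by some
clause of `F`). [folklore] -/
theorem CoreHyp.one_le_r (h : CoreHyp P Fc) : 1 ≤ P.r := by
  obtain ⟨m, hm, -⟩ := h.Fc_unsat fun _ => false
  omega

/-- **[Garlík 2019, Lemma 19, Case 2]: filling a clause.** If `(i, j)` is not `D`-mentioned
in `E` and its clause is unset in an admissible `σ` that falsifies `E` where defined and covers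
`E`, then `σ` extends to an admissible assignment with the clause of `(i, j)` set, still
falsifying `E` where defined, and unchanged on the other levels. (Set the cut variable /
`F`-clause index first if needed, avoiding the positive literals of `E`; then set a full clause —
containing `C_m` on level `0` — or the empty clause at the last pair.)
[cite: Garlik2019, Lemma 19 (proof, Case 2)] -/
theorem exists_fillD (hP : CoreHyp P Fc) (hσ : Admissible P Fc σ) (hF : Falsi P σ E)
    (hC : Covered P σ E) {i j : ℕ} (hi : i < P.s) (hj : j < P.t) (hD : σ.D (i, j) = none) :
    ∃ τ : PA, Admissible P Fc τ ∧ Ext σ τ ∧ Falsi P τ E ∧ τ.D (i, j) ≠ none ∧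
      (τ.L = σ.L ∧ τ.R = σ.R) ∧ ∀ i', i' ≠ i → setPairs P τ i' = setPairs P σ i' := by
  have hnm : ¬ DMen P E i j := hC.not_DMen hD
  rcases Nat.eq_zero_or_pos i with rfl | hipos
  · -- level 0: first make sure `I j` is set
    obtain ⟨σ₁, m, hσ₁, hE₁, hF₁, hI₁, hD₁, hm, hsame⟩ : ∃ σ₁ : PA, ∃ m : ℕ, Admissible P Fc σ₁ ∧
        Ext σ σ₁ ∧ Falsi P σ₁ E ∧ σ₁.I j = some m ∧ σ₁.D = σ.D ∧ m < P.r ∧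
        (σ₁.V = σ.V ∧ σ₁.L = σ.L ∧ σ₁.R = σ.R) := by
      cases hIj : σ.I j with
      | some m =>
        exact ⟨σ, m, hσ, Ext.refl σ, hF, hIj, rfl, (hσ.I_range j m hIj).2, rfl, rfl, rfl⟩
      | none =>
        obtain ⟨hneg, m, hm, hpos⟩ := exists_free_I hj (hC.not_IImp hIj)
        exact ⟨σ.setI j m, m, hσ.setI hD hj hm, Ext.setI (Or.inl hIj), hF.setI hneg hpos,
          by simp, rfl, hm, rfl, rfl, rfl⟩
    set C := fullExt P.n (Fc m) with hCdef
    have hCfull : IsFullCl P.n C := isFullCl_fullExt (hP.Fc_range m hm) (hP.Fc_nonTaut m hm)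
    have hD₁' : σ₁.D (0, j) = none := by rw [hD₁]; exact hD
    refine ⟨σ₁.setD (0, j) C, hσ₁.setD_zero hD₁' hI₁ hP.one_lt_s hj hCfull (subset_fullExt _ _),
      hE₁.trans (Ext.setD hD₁' C), hF₁.setD hnm C, by simp, ⟨hsame.2.1, hsame.2.2⟩,
      fun i' hi' => ?_⟩
    apply setPairs_congr
    intro j'
    refine ⟨?_, ?_, ?_, ?_, fun h => absurd h hi'⟩
    · simp [hi', hD₁]
    · simp [hsame.1]
    · simp [hsame.2.1]
    · simp [hsame.2.2]
  · -- level `p + 1`: first make sure `V (p+1, j)` is set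
    obtain ⟨p, rfl⟩ : ∃ p, i = p + 1 := ⟨i - 1, by omega⟩
    obtain ⟨σ₁, ℓ, hσ₁, hE₁, hF₁, hV₁, hD₁, hℓ, hsame⟩ : ∃ σ₁ : PA, ∃ ℓ : ℕ, Admissible P Fc σ₁ ∧
        Ext σ σ₁ ∧ Falsi P σ₁ E ∧ σ₁.V (p + 1, j) = some ℓ ∧ σ₁.D = σ.D ∧ ℓ < P.n ∧
        (σ₁.I = σ.I ∧ σ₁.L = σ.L ∧ σ₁.R = σ.R ∧ ∀ q, q ≠ (p + 1, j) → σ₁.V q = σ.V q) := by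
      cases hVj : σ.V (p + 1, j) with
      | some ℓ =>
        exact ⟨σ, ℓ, hσ, Ext.refl σ, hF, hVj, rfl, (hσ.V_range _ j ℓ hVj).2.2.2, rfl, rfl, rfl,
          fun _ _ => rfl⟩
      | none =>
        obtain ⟨hneg, ℓ, hℓ, hpos⟩ :=
          exists_free_V hP.one_le_n (by omega) hi hj (hC.not_VImp hVj)
        exact ⟨σ.setV (p + 1, j) ℓ, ℓ, hσ.setV hD hi hj hℓ, Ext.setV (Or.inl hVj),
          hF.setV hneg hpos, by simp, rfl, hℓ, rfl, rfl, rfl,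
          fun q hq => by simp [hq]⟩
    have hD₁' : σ₁.D (p + 1, j) = none := by rw [hD₁]; exact hD
    by_cases hlast : p + 2 = P.s ∧ j + 1 = P.t
    · refine ⟨σ₁.setD (p + 1, j) ∅, hσ₁.setD_succ hD₁' (by rw [hV₁]; simp) hi hj
        (Or.inr ⟨rfl, hlast⟩), hE₁.trans (Ext.setD hD₁' ∅), hF₁.setD hnm ∅, by simp,
        ⟨hsame.2.1, hsame.2.2.1⟩, fun i' hi' => ?_⟩
      apply setPairs_congr
      intro j'
      refine ⟨?_, ?_, ?_, ?_, fun _ => ?_⟩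
      · simp [hi', hD₁]
      · exact hsame.2.2.2 _ (by simp [hi'])
      · simp [hsame.2.1]
      · simp [hsame.2.2.1]
      · simp [hsame.1]
    · refine ⟨σ₁.setD (p + 1, j) (allNeg P.n), hσ₁.setD_succ hD₁' (by rw [hV₁]; simp) hi hj
        (Or.inl ⟨isFullCl_allNeg P.n, hlast⟩), hE₁.trans (Ext.setD hD₁' _), hF₁.setD hnm _,
        by simp, ⟨hsame.2.1, hsame.2.2.1⟩, fun i' hi' => ?_⟩
      apply setPairs_congr
      intro j'
      refine ⟨?_, ?_, ?_, ?_, fun _ => ?_⟩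
      · simp [hi', hD₁]
      · exact hsame.2.2.2 _ (by simp [hi'])
      · simp [hsame.2.1]
      · simp [hsame.2.2.1]
      · simp [hsame.1]

end Fill




end LevelledRefCNF

end Literature.Computability.MetaComplexity
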